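import Summits.QuantumFields.BalabanUV.T4Continuum.Support.VariationalColourTowerEndLocal
import Summits.QuantumFields.BalabanUV.T4Continuum.Support.VariationalColourLipschitzRepair

/-!
# T⁴ programme, spine node NE2 (U1a), lane P2 — SUPPLIER ITEM «V-COL-TWO-RUNS», file 2 of 2: THE COLOUR 0-FORM TWO-RUNS END (frame-free) —
# `TowerLimitRate (fun _ ↦ 1) 1 (k ↦ X_k(run k)) (C_pair + C_lip) ρ₀`, `ρ₀ = max(L⁻¹, θ)`, for a tower whose level-`k` member is the colour effective
# operator of the `k`-th RUN's data `(Rc k, T k)` and whose level `k+1` is run `k+1`'s canonical pair over ITS OWN coarse partner `(Rb k, Tb k)`, the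
# two runs tied at level `k` ONLY by the RAW distances `n·‖Rb k − Rc k‖ ≤ c_ρ·θ^k` (operator norm), `‖Tb k − T k‖ ≤ c_τ·θ^k` — node NE3's currency,
# a HYPOTHESIS here (the colour twin of the scalar road's ROOT R `VariationalCovariantEndLocal.towerLimitRate_twoRuns_closed_local`, p215541)

NE2 formalisation swarm `b2b-balaban-t4-ne2-formalise-*`, leaf prover 02 (gen 6); register P2-sup, item «V-COL-TWO-RUNS» (INTENT CLAIMS.log l.17982).
MECHANISM (as the scalar `VariationalCovariantTwoRunsEnd`, p215328): per level, the frame-free colour canonical-pair bracket of run `k+1`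
(`VariationalColourTowerEndLocal.colour_pair_closed_local`, p227350 — every leaf discharged, UB⁺-colour relative to a unitary reference `Tb₀ k`) between
`Δ_k(Rb k, Tb k)` and `Δ_{k+1}(Rc (k+1), T (k+1))` (COMP⁺ for run `k+1`: `T (k+1) = compTv (Tb k) (T′ k)`, `Rc (k+1) = Rtrv (R′ k)`, transported by gen 5's
`blockSpin_colour_pair_transport`), PLUS the two-runs face at level `k` by CONSTRAINT REPAIR (file 1 `colour_repair_abs`: `|Δ_k(Rb k,Tb k)(μ) − Δ_k(Rc k,T k)(μ)| ≤
e_L·nsqv μ`) ⟹ level brackets with defects `e + e_L`, `e′ + e_L` ⟹ D-E `towerLimitRate_effC` (p220569).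
 * §1 `repair_const_eq_eV` (file 1's constant IS `eV Λ C_P δ₀` at `δ₀ = √d·(nρ) + √Λ·τ`), `deltaLip_level_le` (its rate under the two-run class);
 * §2 **`towerLimitRate_colourTwoRuns_of_brackets`** (pair brackets at `(Rb k, Tb k)` + repair face + COMP⁺ + rates ⟹ the tower);
 * §3 **`towerLimitRate_colourTwoRuns_closed_local`** — binders: run `k`'s data `(Rc k, T k)` UNITARY with leaf UB⁺ (constant `Λc(n·w′_k)`) and P⁺ (`136`) in LEAF
   SHAPE; run `k+1`'s coarse partner `(Rb k, Tb k)` with ITS frame-free pair data EXACTLY as in `colour_pair_closed_local` (reference `Tb₀ k`, `w₀ k`, `γ`, `hsmall k`,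
   `w′ k`, one-step `T′ k` ∕ `R′ k` ∕ `w₁ k` ∕ `m k` ∕ `m₁ k`, plaquette `p k`), the pair's CLASS (`n·w′_k ≤ c_w′`, `p_k·n² ≤ c_p`, `n²·m_k ≤ c_m`, `n²·m₁,k ≤ c₁`) and the
   TWO-RUN CLASS `‖Rb k y μ − Rc k y μ‖ ≤ ρ_k`, `‖Tb k x − T k x‖ ≤ τ_k`, `n·ρ_k ≤ c_ρθ^k`, `τ_k ≤ c_τθ^k`, `0 ≤ θ < 1`, `2 ≤ L` ⟹
   `TowerLimitRate (fun _ ↦ 1) 1 (k ↦ effC (L^k) M (Rc k) (T k) b a) (C_pair + C_lip) (max L⁻¹ θ)`, `C_pair = eV Λ⋆ 136 (√d·c_m) + ePV Λ⋆ 136 C_R⋆ c_ε c_δ′`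
   (p227350's constant VERBATIM), `C_lip = eV Λc⋆ 136 (√d·c_ρ + √Λc⋆·c_τ)`.  NE3 NOT discharged (the two-run class is DISPLAYED); NO frame; NE2 NOT proved.

HONEST FRAMING (T4-DAG p. 1).  MODEL LEVEL: all operators ∕ transports ∕ defects are DATA (no identification with Bałaban's `U(Γ)`, c5, no B0); the two-run
distances `ρ_k`, `τ_k` with their rate `θ` are HYPOTHESES in node NE3's currency (a colour NE3 adapter in the manner of leaf-09-g4's `VariationalCovariantTwoRuns(NE3)`
is NOT written here; NE3 itself OPEN); honest limit «small field PER UNIT BLOCK, k-uniform under the class»; [folklore] plumbing + real arithmetic; nothing printed is a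
hypothesis; no `def`, no `def … : Prop`, no `sorry`; axioms standard.  NE2 NOT proved on either road; spine PROVED 0∕9; rung (B)+1 finite T⁴ — NOT infinite volume,
NOT mass gap, NOT Clay.  HONEST DEPENDENCY (cell, verbatim): continuum YM on T⁴ ⇐ BetaPertH ∧ nine spine estimates (0/9 proved); BetaPertH ⇐ (D1) ∧ (D4) ∧ CAP+tail;
G-an2-4 gates asym, D1 and NE2/3/4.
-/

noncomputable section

namespace Summit.QuantumFields.BalabanUV.T4Continuum.VariationalColourTwoRunsEnd

open Finset
open scoped Matrix
open Literature.MathematicalPhysics.QuantumFieldTheory.Balaban1983to89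
open Literature.MathematicalPhysics.QuantumFieldTheory.Balaban1983to89.B5Prop11Plancherel (Tor fine unitVec)
open Literature.MathematicalPhysics.QuantumFieldTheory.Balaban1983to89.B5Block118 (bpt)
open Literature.MathematicalPhysics.QuantumFieldTheory.Balaban1983to89.B5Blocks16 (blockOf)
open Summit.QuantumFields.BalabanUV.T4Continuum.VariationalTransfer (blockSpin)
open Summit.QuantumFields.BalabanUV.T4Continuum.CovariantAveragingTower (TowerLimitRate)
open Summit.QuantumFields.BalabanUV.T4Continuum.VariationalColourFederbush (misv norm_le_one_of_mem_unitary)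
open Summit.QuantumFields.BalabanUV.T4Continuum.VariationalColourUpperBound (nsqv nsqv_nonneg)
open Summit.QuantumFields.BalabanUV.T4Continuum.VariationalColourScalarPair (Scv Sfv qWv Qkv Q1v apply_star_apply)
open Summit.QuantumFields.BalabanUV.T4Continuum.VariationalColourPoincarePhys (qWv_le_coarse_rel)
open Summit.QuantumFields.BalabanUV.T4Continuum.VariationalColourTower (compTv Rtrv)
open Summit.QuantumFields.BalabanUV.T4Continuum.VariationalEffectiveHilbertPairs (effC towerLimitRate_effC)
open Summit.QuantumFields.BalabanUV.T4Continuum.VariationalVectorEndOfLeaves (eV ePV eV_nonneg ePV_nonneg eV_level_le ePV_level_le levelV_facts)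
open Summit.QuantumFields.BalabanUV.T4Continuum.VariationalColourTowerEnd
  (blockSpin_colour_pair_transport delta_level_le eps1_level_le deltaP_level_le Lamc_level_le CR_level_le Lam_level_le)
open Summit.QuantumFields.BalabanUV.T4Continuum.VariationalColourTowerEndLocal (hUBc_colour_rel colour_pair_closed_local)
open Summit.QuantumFields.BalabanUV.T4Continuum.VariationalColourLipschitzRepair (colour_repair_abs)

variable {d : ℕ} {E : Type*} [NormedAddCommGroup E] [InnerProductSpace ℂ E] [CompleteSpace E] [FiniteDimensional ℂ E]

/-! ## §1 The two-runs defect constant is `eV` at `δ₀ = √d·(nρ) + √Λ·τ`, and its rate -/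

omit [CompleteSpace E] [FiniteDimensional ℂ E] in
/-- file 1's repair constant `2·D·√Λ + D²`, `D = δ₀·√(C_P(Λ+1))`, IS `eV Λ C_P δ₀`. [folklore] -/
theorem repair_const_eq_eV {Λ CP δ₀ : ℝ} (hΛ : 0 ≤ Λ) (hCP : 0 ≤ CP) :
    2 * (δ₀ * Real.sqrt (CP * (Λ + 1))) * Real.sqrt Λ + (δ₀ * Real.sqrt (CP * (Λ + 1))) ^ 2 = eV Λ CP δ₀ := by
  unfold eV
  have hX : 0 ≤ CP * (Λ + 1) := by positivity
  rw [Real.sqrt_mul hΛ, mul_pow, Real.sq_sqrt hX]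
  ring

omit [CompleteSpace E] [FiniteDimensional ℂ E] in
/-- the repair datum decays under the two-run class: `n·ρ ≤ c_ρθ^k`, `τ ≤ c_τθ^k`, `Λ ≤ Λ⋆` ⟹ `√d·(nρ) + √Λ·τ ≤ (√d·c_ρ + √Λ⋆·c_τ)·θ^k`. [folklore] -/
theorem deltaLip_level_le {n ρ τ Λ Λs cρ cτ θ : ℝ} (k : ℕ) (hΛs : Λ ≤ Λs) (hτ : 0 ≤ τ)
    (hρc : n * ρ ≤ cρ * θ ^ k) (hτc : τ ≤ cτ * θ ^ k) :
    Real.sqrt d * (n * ρ) + Real.sqrt Λ * τ ≤ (Real.sqrt d * cρ + Real.sqrt Λs * cτ) * θ ^ k := by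
  have h1 : Real.sqrt d * (n * ρ) ≤ Real.sqrt d * (cρ * θ ^ k) := mul_le_mul_of_nonneg_left hρc (Real.sqrt_nonneg _)
  have h2 : Real.sqrt Λ * τ ≤ Real.sqrt Λs * (cτ * θ ^ k) :=
    mul_le_mul (Real.sqrt_le_sqrt hΛs) hτc hτ (Real.sqrt_nonneg _)
  nlinarith

/-! ## §2 The two-runs tower from brackets -/

section Tower

variable (L : ℕ) [NeZero L] (M : Fin d → ℕ) [hM : ∀ μ, NeZero (M μ)] {κ : Type*} [Fintype κ] [DecidableEq κ]
variable (Rc Rb : (k : ℕ) → Tor (fine (L ^ k) M) → Fin d → (E →L[ℂ] E)) (T Tb : (k : ℕ) → Tor (fine (L ^ k) M) → (E →L[ℂ] E))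
variable (R' : (k : ℕ) → Tor (fine L (fine (L ^ k) M)) → Fin d → (E →L[ℂ] E)) (T' : (k : ℕ) → Tor (fine L (fine (L ^ k) M)) → (E →L[ℂ] E))

omit [FiniteDimensional ℂ E] in
/-- **TWO-RUNS COLOUR TOWER FROM BRACKETS**: per level, the canonical-pair brackets of run `k+1` over its coarse partner `(Rb k, Tb k)` with defects `e k, e′ k`,
the two-runs face `|Δ_k(Rb k,Tb k) − Δ_k(Rc k,T k)| ≤ eL k·nsqv`, COMP⁺ for run `k+1`, UNITARY `T k`, leaf P⁺-colour for the run-`k` data, and rates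
`e k + eL k, e′ k + eL k ≤ C·ρ₀^k` ⟹ `TowerLimitRate (fun _ ↦ 1) 1 (k ↦ effC (L^k) M (Rc k) (T k) b a) C ρ₀`. [folklore] -/
theorem towerLimitRate_colourTwoRuns_of_brackets (hT : ∀ k x, T k x ∈ unitary (E →L[ℂ] E)) {CP : ℕ → ℝ}
    (hPc : ∀ k f, qWv (L ^ k) M f ≤ CP k * (Scv (L ^ k) M (Rc k) f + nsqv (Qkv (L ^ k) M (T k) f)))
    (hTcomp : ∀ k, T (k + 1) = compTv (L ^ k) L M (Tb k) (T' k)) (hRtr : ∀ k, Rc (k + 1) = Rtrv (L ^ k) L M (R' k))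
    (b : OrthonormalBasis κ ℂ E) {a : ℝ} (ha : 0 < a) {C ρ₀ : ℝ} (hC : 0 ≤ C) (hρ₀ : 0 ≤ ρ₀) (hρ₀1 : ρ₀ < 1) (e e' eL : ℕ → ℝ)
    (he : ∀ k, e k + eL k ≤ C * ρ₀ ^ k) (he' : ∀ k, e' k + eL k ≤ C * ρ₀ ^ k)
    (hpair : ∀ k (μ : Tor M → E), blockSpin (Qkv (L ^ k) M (Tb k)) (Scv (L ^ k) M (Rb k)) μ
        ≤ blockSpin (Qkv (L ^ k) M (Tb k) ∘ Q1v (L ^ k) L M (T' k)) (Sfv (L ^ k) L M (R' k)) μ + e k * nsqv μ ∧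
      blockSpin (Qkv (L ^ k) M (Tb k) ∘ Q1v (L ^ k) L M (T' k)) (Sfv (L ^ k) L M (R' k)) μ
        ≤ blockSpin (Qkv (L ^ k) M (Tb k)) (Scv (L ^ k) M (Rb k)) μ + e' k * nsqv μ)
    (hlip : ∀ k (μ : Tor M → E),
      |blockSpin (Qkv (L ^ k) M (Tb k)) (Scv (L ^ k) M (Rb k)) μ - blockSpin (Qkv (L ^ k) M (T k)) (Scv (L ^ k) M (Rc k)) μ| ≤ eL k * nsqv μ) :
    TowerLimitRate (ι := fun _ => Tor M × κ) (fun _ => (1 : Matrix (Tor M × κ) (Tor M × κ) ℂ)) 1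
      (fun k => effC (L ^ k) M (Rc k) (T k) b a) C ρ₀ := by
  refine towerLimitRate_effC L M Rc T (fun k x => star (T k x)) (fun k x v => apply_star_apply (hT k x) v) hPc b ha hC hρ₀ hρ₀1
    (fun k => e k + eL k) (fun k => e' k + eL k) he he' fun k μ => ?_
  have hlev : blockSpin (Qkv (L ^ (k + 1)) M (T (k + 1))) (Scv (L ^ (k + 1)) M (Rc (k + 1))) μ
      = blockSpin (Qkv (L ^ k) M (Tb k) ∘ Q1v (L ^ k) L M (T' k)) (Sfv (L ^ k) L M (R' k)) μ := by
    have e1 : blockSpin (Qkv (L ^ (k + 1)) M (T (k + 1))) (Scv (L ^ (k + 1)) M (Rc (k + 1))) μ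
        = blockSpin (Qkv (L ^ k * L) M (compTv (L ^ k) L M (Tb k) (T' k))) (Scv (L ^ k * L) M (Rtrv (L ^ k) L M (R' k))) μ := by
      rw [hTcomp k, hRtr k]; rfl
    rw [e1, ← blockSpin_colour_pair_transport]
  rw [hlev]
  have hp := hpair k μ
  have hl := abs_le.mp (hlip k μ)
  constructor
  · nlinarith [hp.1, hl.1, hl.2]
  · nlinarith [hp.2, hl.1, hl.2]

end Tower

/-! ## §3 THE COLOUR TWO-RUNS END: every per-level leaf discharged; NE3's currency as the two-run CLASS -/

section Closed

variable (L : ℕ) [NeZero L] (M : Fin d → ℕ) [hM : ∀ μ, NeZero (M μ)] {κ : Type*} [Fintype κ] [DecidableEq κ]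
variable (Rc Rb : (k : ℕ) → Tor (fine (L ^ k) M) → Fin d → (E →L[ℂ] E)) (T Tb Tb₀ : (k : ℕ) → Tor (fine (L ^ k) M) → (E →L[ℂ] E))
variable (R' : (k : ℕ) → Tor (fine L (fine (L ^ k) M)) → Fin d → (E →L[ℂ] E)) (T' : (k : ℕ) → Tor (fine L (fine (L ^ k) M)) → (E →L[ℂ] E))

/-- **THE COLOUR 0-FORM TWO-RUNS END (P2, E-valued 0-forms with operator transports, frame-free, model level).**  Level `k` carries the `k`-th run's data
`(Rc k, T k)` (UNITARY `T k`; leaf UB⁺ with constant `2d·36^d·((1 + n·w′_k)² + 9)` and leaf P⁺ with `C_P = 136` in LEAF SHAPE) and the `k+1`-st run's COARSE PARTNER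
`(Rb k, Tb k)` with ITS canonical pair data exactly as in `colour_pair_closed_local` (UNITARY `Rb k` with plaquette `p k`, UNITARY `Tb k`, UNITARY reference `Tb₀ k`
with in-block defect `w₀ k`, relative operator `γ < 1`, `2d(n·w₀ k)² + 4γ² ≤ ½`, fictitious `w′ k`; UNITARY one-step `T′ k`, contractive `R′ k`, `w₁ k`, mismatch `m k`,
one-step defects `m₁ k`), COMP⁺ for run `k+1` (`T (k+1) = compTv (Tb k) (T′ k)`, `Rc (k+1) = Rtrv (R′ k)`), the pair's CLASS (`n·w′_k ≤ c_w′`, `p_k·n² ≤ c_p`,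
`n²·m_k ≤ c_m`, `n²·m₁,k ≤ c₁`), and the TWO-RUN CLASS in node NE3's currency: RAW distances `‖Rb k − Rc k‖ ≤ ρ_k` (operator norm), `‖Tb k − T k‖ ≤ τ_k` with
`n·ρ_k ≤ c_ρ·θ^k`, `τ_k ≤ c_τ·θ^k`, `0 ≤ θ < 1`, `2 ≤ L`.  THEN
`TowerLimitRate (fun _ ↦ 1) 1 (fun k => effC (L^k) M (Rc k) (T k) b a) (C_pair + C_lip) (max L⁻¹ θ)`, `C_pair = eV Λ⋆ 136 (√d·c_m) + ePV Λ⋆ 136 C_R⋆ c_ε c_δ′`,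
`C_lip = eV Λc⋆ 136 (√d·c_ρ + √Λc⋆·c_τ)`.  NO frame, NO leaf binder except UB⁺∕P⁺ of the run-`k` data in leaf shape; NE3 NOT discharged; NE2 NOT proved. [folklore] -/
theorem towerLimitRate_colourTwoRuns_closed_local (hL : 2 ≤ L)
    -- run k's data in leaf shape
    (hT : ∀ k x, T k x ∈ unitary (E →L[ℂ] E)) (w' : ℕ → ℝ) (hw'0 : ∀ k, 0 ≤ w' k)
    (hUBk : ∀ k (μ : Tor M → E), ∃ f, Qkv (L ^ k) M (T k) f = μ ∧
      Scv (L ^ k) M (Rc k) f ≤ 2 * d * (36 : ℝ) ^ d * ((1 + (((L ^ k : ℕ)) : ℝ) * w' k) ^ 2 + 9) * nsqv μ)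
    (hPk : ∀ k f, qWv (L ^ k) M f ≤ 136 * (Scv (L ^ k) M (Rc k) f + nsqv (Qkv (L ^ k) M (T k) f)))
    -- run k+1's coarse partner and its pair data (COMP⁺ for run k+1)
    (hTcomp : ∀ k, T (k + 1) = compTv (L ^ k) L M (Tb k) (T' k)) (hRtr : ∀ k, Rc (k + 1) = Rtrv (L ^ k) L M (R' k))
    (hTb : ∀ k x, Tb k x ∈ unitary (E →L[ℂ] E)) (hRb : ∀ k x μ, Rb k x μ ∈ unitary (E →L[ℂ] E))
    (p : ℕ → ℝ) (hp : ∀ k, 0 ≤ p k)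
    (hP : ∀ k x μ ν, ‖Rb k x μ * Rb k (x + unitVec (fine (L ^ k) M) μ) ν - Rb k x ν * Rb k (x + unitVec (fine (L ^ k) M) ν) μ‖ ≤ p k)
    (hTb₀ : ∀ k x, Tb₀ k x ∈ unitary (E →L[ℂ] E)) (w₀ : ℕ → ℝ) (hw0 : ∀ k, 0 ≤ w₀ k)
    (hw₀ : ∀ k (x : Tor (fine (L ^ k) M)) (μ : Fin d), blockOf (L ^ k) M (x + unitVec (fine (L ^ k) M) μ) = blockOf (L ^ k) M x →
      ‖Rb k x μ * star (Tb₀ k (x + unitVec (fine (L ^ k) M) μ)) * Tb₀ k x - 1‖ ≤ w₀ k)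
    {γ : ℝ} (hγ : γ < 1) (hrel : ∀ k x, ‖Tb k x * star (Tb₀ k x) - 1‖ ≤ γ)
    (hsmall : ∀ k, 2 * (d : ℝ) * ((((L ^ k : ℕ)) : ℝ) * w₀ k) ^ 2 + 4 * γ ^ 2 ≤ 1 / 2)
    (hw' : ∀ k, (4 + (((L ^ k : ℕ)) : ℝ) * w₀ k) / (1 - γ) - 1 ≤ (((L ^ k : ℕ)) : ℝ) * w' k)
    (hT' : ∀ k x, T' k x ∈ unitary (E →L[ℂ] E)) (hR' : ∀ k x μ, ‖R' k x μ‖ ≤ 1) (w₁ : ℕ → ℝ)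
    (hw₁ : ∀ k (x : Tor (fine L (fine (L ^ k) M))) (μ : Fin d),
      blockOf L (fine (L ^ k) M) (x + unitVec (fine L (fine (L ^ k) M)) μ) = blockOf L (fine (L ^ k) M) x →
      ‖R' k x μ * star (T' k (x + unitVec (fine L (fine (L ^ k) M)) μ)) * T' k x - 1‖ ≤ w₁ k)
    (hsmall₁ : ∀ k, 2 * (d : ℝ) * ((L : ℝ) * w₁ k) ^ 2 ≤ 1 / 2)
    (m : ℕ → ℝ) (hm : ∀ k, 0 ≤ m k) (hmis : ∀ k y μ j, ‖misv L (fine (L ^ k) M) (Rb k) (R' k) (T' k) y μ j‖ ≤ m k)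
    (habsorb : ∀ k, 64 * (d : ℝ) * ((((L ^ k : ℕ)) : ℝ) * m k) ^ 2 ≤ 1 / 2)
    (m₁ : ℕ → ℝ) (hm₁ : ∀ k, 0 ≤ m₁ k)
    (hin : ∀ k (y : Tor (fine (L ^ k) M)) (j : Fin d → Fin L) (μ : Fin d), (j μ : ℕ) + 1 < L →
      ‖R' k (bpt L (fine (L ^ k) M) y j) μ * star (T' k (bpt L (fine (L ^ k) M) y j + unitVec (fine L (fine (L ^ k) M)) μ))
        - star (T' k (bpt L (fine (L ^ k) M) y j))‖ ≤ m₁ k)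
    (hcross : ∀ k (y : Tor (fine (L ^ k) M)) (j : Fin d → Fin L) (μ : Fin d), (j μ : ℕ) + 1 = L →
      ‖R' k (bpt L (fine (L ^ k) M) y j) μ * star (T' k (bpt L (fine (L ^ k) M) y j + unitVec (fine L (fine (L ^ k) M)) μ))
        - star (T' k (bpt L (fine (L ^ k) M) y j)) * Rb k y μ‖ ≤ m₁ k)
    -- the pair's classes
    {cw cp cm c₁ : ℝ} (hcw : ∀ k, (((L ^ k : ℕ)) : ℝ) * w' k ≤ cw) (hcp : ∀ k, p k * (((L ^ k : ℕ)) : ℝ) ^ 2 ≤ cp)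
    (hcm : ∀ k, (((L ^ k : ℕ)) : ℝ) ^ 2 * m k ≤ cm) (hc₁ : ∀ k, (((L ^ k : ℕ)) : ℝ) ^ 2 * m₁ k ≤ c₁)
    -- the TWO-RUN CLASS (node NE3's currency, displayed)
    {θ cρ cτ : ℝ} (hθ0 : 0 ≤ θ) (hθ1 : θ < 1) (ρ τ : ℕ → ℝ)
    (hρ0 : ∀ k, 0 ≤ ρ k) (hρ : ∀ k y μ, ‖Rb k y μ - Rc k y μ‖ ≤ ρ k) (hρc : ∀ k, (((L ^ k : ℕ)) : ℝ) * ρ k ≤ cρ * θ ^ k)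
    (hτ0 : ∀ k, 0 ≤ τ k) (hτ : ∀ k x, ‖Tb k x - T k x‖ ≤ τ k) (hτc : ∀ k, τ k ≤ cτ * θ ^ k)
    (b : OrthonormalBasis κ ℂ E) {a : ℝ} (ha : 0 < a) :
    let Λcs : ℝ := 2 * d * (36 : ℝ) ^ d * ((1 + cw) ^ 2 + 9)
    let CRs : ℝ := 2 * Λcs + 2 * d * cp + (d : ℝ) ^ 2 * cp ^ 2 * 136
    let cε : ℝ := ((d : ℝ) / 4 + 1 / 2) * L
    let cδ' : ℝ := Real.sqrt (2 * d * (1 + (d : ℝ) ^ 2)) * ((L : ℝ) * c₁)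
    let Λs : ℝ := Λcs + (cε * CRs + 2 * cδ' * Real.sqrt ((1 + cε * CRs) * 136) + cδ' ^ 2 * 136) * (Λcs + 1)
    TowerLimitRate (ι := fun _ => Tor M × κ) (fun _ => (1 : Matrix (Tor M × κ) (Tor M × κ) ℂ)) 1
      (fun k => effC (L ^ k) M (Rc k) (T k) b a)
      (eV Λs 136 (Real.sqrt d * cm) + ePV Λs 136 CRs cε cδ' + eV Λcs 136 (Real.sqrt d * cρ + Real.sqrt Λcs * cτ)) (max ((L : ℝ)⁻¹) θ) := by
  intro Λcs CRs cε cδ' Λs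
  have hL1 : (1 : ℝ) ≤ L := by exact_mod_cast (show 1 ≤ L by omega)
  have hL0 : (0 : ℝ) < L := by linarith
  have hθL0 : (0 : ℝ) ≤ (L : ℝ)⁻¹ := by positivity
  have hθL1 : ((L : ℝ)⁻¹) < 1 := inv_lt_one_of_one_lt₀ (by exact_mod_cast (show 1 < L by omega))
  have hθL1' : ((L : ℝ)⁻¹) ≤ 1 := hθL1.le
  have hρ₀0 : 0 ≤ max ((L : ℝ)⁻¹) θ := le_max_of_le_left hθL0
  have hρ₀1 : max ((L : ℝ)⁻¹) θ < 1 := max_lt hθL1 hθ1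
  have hd : (0 : ℝ) ≤ d := Nat.cast_nonneg d
  -- the level constants of `colour_pair_closed_local` at `n = L^k` for the coarse partner `(Rb k, Tb k)`
  let nk : ℕ → ℝ := fun k => (((L ^ k : ℕ)) : ℝ)
  let Λc : ℕ → ℝ := fun k => 2 * d * (36 : ℝ) ^ d * ((1 + nk k * w' k) ^ 2 + 9)
  let CR : ℕ → ℝ := fun k => 2 * Λc k + 2 * d * (p k * nk k ^ 2) + (d : ℝ) ^ 2 * (p k * nk k ^ 2) ^ 2 * 136
  let ε₁ : ℕ → ℝ := fun k => ((d : ℝ) / 4 + 1 / 2) * ((L : ℝ) / nk k ^ 2)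
  let δ' : ℕ → ℝ := fun k => Real.sqrt (2 * d * (1 + (d : ℝ) ^ 2)) * (nk k * L * m₁ k)
  let Λ : ℕ → ℝ := fun k => Λc k + (ε₁ k * CR k + 2 * δ' k * Real.sqrt ((1 + ε₁ k * CR k) * 136) + δ' k ^ 2 * 136) * (Λc k + 1)
  let δ : ℕ → ℝ := fun k => Real.sqrt d * (nk k * m k)
  let δL : ℕ → ℝ := fun k => Real.sqrt d * (nk k * ρ k) + Real.sqrt (Λc k) * τ k
  -- class facts per level
  have hnk0 : ∀ k, 0 ≤ nk k := fun k => by positivity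
  have hx : ∀ k, 0 ≤ nk k * w' k := fun k => mul_nonneg (hnk0 k) (hw'0 k)
  have hcw0 : 0 ≤ cw := (hx 0).trans (hcw 0)
  have hα0 : ∀ k, 0 ≤ p k * nk k ^ 2 := fun k => by have := hp k; positivity
  have hcp0 : 0 ≤ cp := (hα0 0).trans (hcp 0)
  have hΛc0 : ∀ k, 0 ≤ Λc k := fun k => by have := hx k; positivity
  have hΛcs : ∀ k, Λc k ≤ Λcs := fun k => Lamc_level_le (hx k) (hcw k)
  have hΛcs0 : 0 ≤ Λcs := (hΛc0 0).trans (hΛcs 0)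
  have hCR0 : ∀ k, 0 ≤ CR k := fun k => by have := hΛc0 k; have := hα0 k; positivity
  have hCRs : ∀ k, CR k ≤ CRs := fun k => CR_level_le (hΛcs k) (hα0 k) (hcp k)
  have hCRs0 : 0 ≤ CRs := (hCR0 0).trans (hCRs 0)
  have hε0 : ∀ k, 0 ≤ ε₁ k := fun k => by have := hnk0 k; positivity
  have hεθ : ∀ k, ε₁ k ≤ cε * ((L : ℝ)⁻¹) ^ k := fun k => eps1_level_le L hL1 k
  have hcε0 : 0 ≤ cε := by positivity
  have hε1 : ∀ k, ε₁ k ≤ cε := fun k => (hεθ k).trans (mul_le_of_le_one_right hcε0 (pow_le_one₀ hθL0 hθL1'))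
  have hδ'0 : ∀ k, 0 ≤ δ' k := fun k => by have := hnk0 k; have := hm₁ k; positivity
  have hδ'θ : ∀ k, δ' k ≤ cδ' * ((L : ℝ)⁻¹) ^ k := fun k => deltaP_level_le L hL1 k (hc₁ k)
  have hcδ'0 : 0 ≤ cδ' := (hδ'0 0).trans (by simpa using hδ'θ 0)
  have hδ'1 : ∀ k, δ' k ≤ cδ' := fun k => (hδ'θ k).trans (mul_le_of_le_one_right hcδ'0 (pow_le_one₀ hθL0 hθL1'))
  have hΛ0 : ∀ k, 0 ≤ Λ k := fun k => by
    have := hΛc0 k; have := hCR0 k; have := hε0 k; have := hδ'0 k; positivity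
  have hΛs : ∀ k, Λ k ≤ Λs := fun k => Lam_level_le (hΛc0 k) (hΛcs k) (hCR0 k) (hCRs k) (hε0 k) (hε1 k) (hδ'0 k) (hδ'1 k)
  have hδ0 : ∀ k, 0 ≤ δ k := fun k => by have := hnk0 k; have := hm k; positivity
  have hδθ : ∀ k, δ k ≤ Real.sqrt d * cm * ((L : ℝ)⁻¹) ^ k := fun k => delta_level_le L hL1 k (hcm k)
  have hcm0 : 0 ≤ Real.sqrt d * cm := (hδ0 0).trans (by simpa using hδθ 0)
  have hδL0 : ∀ k, 0 ≤ δL k := fun k => by have := hnk0 k; have := hρ0 k; have := hτ0 k; have := hΛc0 k; positivity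
  have hδLθ : ∀ k, δL k ≤ (Real.sqrt d * cρ + Real.sqrt Λcs * cτ) * θ ^ k := fun k =>
    deltaLip_level_le k (hΛcs k) (hτ0 k) (hρc k) (hτc k)
  have hcL0 : 0 ≤ Real.sqrt d * cρ + Real.sqrt Λcs * cτ := (hδL0 0).trans (by simpa using hδLθ 0)
  -- the three rate constants
  have hE0 : 0 ≤ eV Λs 136 (Real.sqrt d * cm) := eV_nonneg ((hΛ0 0).trans (hΛs 0)) (by norm_num) hcm0
  have hEP0 : 0 ≤ ePV Λs 136 CRs cε cδ' := ePV_nonneg ((hΛ0 0).trans (hΛs 0)) (by norm_num) hCRs0 hcε0 hcδ'0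
  have hEL0 : 0 ≤ eV Λcs 136 (Real.sqrt d * cρ + Real.sqrt Λcs * cτ) := eV_nonneg hΛcs0 (by norm_num) hcL0
  have hC : 0 ≤ eV Λs 136 (Real.sqrt d * cm) + ePV Λs 136 CRs cε cδ' + eV Λcs 136 (Real.sqrt d * cρ + Real.sqrt Λcs * cτ) :=
    add_nonneg (add_nonneg hE0 hEP0) hEL0
  -- powers of the two rates are dominated by powers of their max
  have hp1 : ∀ k, ((L : ℝ)⁻¹) ^ k ≤ (max ((L : ℝ)⁻¹) θ) ^ k := fun k => pow_le_pow_left₀ hθL0 (le_max_left _ _) k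
  have hp2 : ∀ k, θ ^ k ≤ (max ((L : ℝ)⁻¹) θ) ^ k := fun k => pow_le_pow_left₀ hθ0 (le_max_right _ _) k
  -- the per-level defects and their rates
  have he : ∀ k, eV (Λ k) 136 (δ k) ≤ eV Λs 136 (Real.sqrt d * cm) * (max ((L : ℝ)⁻¹) θ) ^ k := fun k =>
    (eV_level_le k (hΛ0 k) (hΛs k) (by norm_num : (0 : ℝ) ≤ 136) le_rfl (hδ0 k) hθL0 hθL1' (hδθ k)).trans
      (mul_le_mul_of_nonneg_left (hp1 k) hE0)
  have he' : ∀ k, ePV (Λ k) 136 (CR k) (ε₁ k) (δ' k) ≤ ePV Λs 136 CRs cε cδ' * (max ((L : ℝ)⁻¹) θ) ^ k := fun k =>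
    (ePV_level_le k (hΛ0 k) (hΛs k) (by norm_num : (0 : ℝ) ≤ 136) le_rfl (hCR0 k) (hCRs k) (hε0 k) hcε0 (hδ'0 k) hcδ'0
      hθL0 hθL1' (hεθ k) (hδ'θ k)).trans (mul_le_mul_of_nonneg_left (hp1 k) hEP0)
  have heL : ∀ k, eV (Λc k) 136 (δL k) ≤ eV Λcs 136 (Real.sqrt d * cρ + Real.sqrt Λcs * cτ) * (max ((L : ℝ)⁻¹) θ) ^ k := fun k =>
    (eV_level_le k (hΛc0 k) (hΛcs k) (by norm_num : (0 : ℝ) ≤ 136) le_rfl (hδL0 k) hθ0 hθ1.le (hδLθ k)).trans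
      (mul_le_mul_of_nonneg_left (hp2 k) hEL0)
  -- UB⁺ ∕ P⁺ RELATIVE for the coarse partner `(Rb k, Tb k)`, in leaf shape
  have hUBb : ∀ k (μ : Tor M → E), ∃ f, Qkv (L ^ k) M (Tb k) f = μ ∧ Scv (L ^ k) M (Rb k) f ≤ Λc k * nsqv μ := fun k =>
    hUBc_colour_rel (L ^ k) M (hTb₀ k) (hRb k) (hw0 k) (hw₀ k) hγ (hrel k) (hw' k)
  have hPb : ∀ k f, qWv (L ^ k) M f ≤ 136 * (Scv (L ^ k) M (Rb k) f + nsqv (Qkv (L ^ k) M (Tb k) f)) := fun k f =>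
    qWv_le_coarse_rel (L ^ k) M (hTb₀ k) (hw₀ k) (hrel k) (hsmall k) f
  refine towerLimitRate_colourTwoRuns_of_brackets L M Rc Rb T Tb R' T' hT hPk hTcomp hRtr b ha hC hρ₀0 hρ₀1
    (fun k => eV (Λ k) 136 (δ k)) (fun k => ePV (Λ k) 136 (CR k) (ε₁ k) (δ' k)) (fun k => eV (Λc k) 136 (δL k))
    (fun k => ?_) (fun k => ?_) (fun k μ => ?_) (fun k μ => ?_)
  · have h1 := he k; have h2 := heL k
    have h3 : 0 ≤ ePV Λs 136 CRs cε cδ' * (max ((L : ℝ)⁻¹) θ) ^ k := mul_nonneg hEP0 (pow_nonneg hρ₀0 k)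
    nlinarith
  · have h1 := he' k; have h2 := heL k
    have h3 : 0 ≤ eV Λs 136 (Real.sqrt d * cm) * (max ((L : ℝ)⁻¹) θ) ^ k := mul_nonneg hE0 (pow_nonneg hρ₀0 k)
    nlinarith
  · exact colour_pair_closed_local (L ^ k) L M (hTb k) (hRb k) (hp k) (hP k) (hTb₀ k) (hw0 k) (hw₀ k) hγ (hrel k) (hsmall k) (hw'0 k) (hw' k)
      (hT' k) (hR' k) (hw₁ k) (hsmall₁ k) (hm k) (hmis k) (habsorb k) (hm₁ k) (hin k) (hcross k) μ
  · have h := colour_repair_abs (L ^ k) M (hρ0 k) (hρ k) (hτ0 k) (hτ k) (hΛc0 k) (by norm_num : (0 : ℝ) ≤ 136) (hUBk k) (hPk k)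
      (hUBb k) (hPb k) μ
    rw [repair_const_eq_eV (hΛc0 k) (by norm_num)] at h
    exact h

end Closed

end Summit.QuantumFields.BalabanUV.T4Continuum.VariationalColourTwoRunsEnd

end
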